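import Literature.NumberTheory.LFunctions.EstermannLemmaDisc
import HarnessLib

/-!
# Siegel's theorem for an abstract family of real characters (MV Theorem 11.14, axiomatised)

Topic `Literature/NumberTheory/LFunctions`, next to `SiegelTheorem.lean` (Montgomery–Vaughan,
*Multiplicative Number Theory I*, Theorem 11.14 for quadratic Dirichlet characters, via
`SiegelEstermannLemma.lean`) and `EstermannLemmaDisc.lean` (Estermann's lemma for `H = (s − 1)F` on a
disc `|s − 2| ≤ R`, `1 < R ≤ 3/2`). Everything in this file is PROVED (one `structure` of hypotheses,
theorems; no named facts).

**Purpose.** Siegel's theorem `L(1, χ) ≫_ε Q^{−ε}` for the real Hecke (ray-class) characters of a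
number field `K` — the ineffective input for the uniformity in `q ≤ (log z)^A` of the prime number
theorem with Grössencharakteren (T. Mitsui, Jap. J. Math. 26 (1956), Lemma 5; D. R. Heath-Brown,
*Primes represented by `x³ + 2y³`*, Acta Math. 186 (2001), Lemma 9.4 and p. 55). MV's proof of
Theorem 11.14 (p. 285, after Estermann and Goldfeld) uses of the characters only a short list of
properties, which we record as the fields of `SiegelFamilyData ι` and under which we run the proof
once. The members `i : ι` (model: pairs `(q, χ)`, `χ` a real character of `(𝓞_K/q)^×` trivial on
units, extended by `0`; for `K = ℚ`, quadratic Dirichlet characters) carry a size `Q i ≥ 1` (model: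
`N(q)`) and a function `L i : ℂ → ℂ` (model: the continuation of `L(s, χ)`); `Z : ℂ → ℂ` is the
zeta-like factor (model: `(s − 1)ζ_K(s)`, `Z(1) = Res_{s=1} ζ_K > 0`). The fields are:

* holomorphy of `Z` and all `L i` on one open `U ⊇ closedBall 2 R` (model: `U = {Re s > θ}` with
  `2 − R > θ`; for `ζ_K` continued by ideal counting `θ = 1 − 1/[K:ℚ]`, `DedekindZetaHalfPlaneProofs`,
  and for `L(s, χ)` continued from the twisted ideal counts, `LSeriesContinuationOfPartialSums`);
* bounds `|Z| ≤ M_Z`, `|L i| ≤ B (Q i)^κ` on the closed disc (model: `‖contF a s‖ ≤ ‖s‖C₀/(σ − θ)`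
  with `C₀ = C Q^B`);
* reality on the real diameter of the disc (`Z_im`, `L_im`), `Z(1) > 0`, `Z(σ) > 0` for `1 < σ ≤ 2`;
* **`L i 1 ≠ 0`** — the one deep input (for `K = ℚ` Dirichlet's theorem; for a number field,
  class field theory or Hecke's functional equation);
* `coeff₁ i`: `Z(s) L_i(s) = (s − 1) ∑ a(n)n^{-s}` on `Re s > 1` with `a ≥ 0`, `a(1) = 1` (model:
  the coefficients of `ζ_K(s)L(s, χ)`, `a(n) = ∑_{N𝔞 = n} ∑_{𝔡 ∣ 𝔞} χ(𝔡) ≥ 0`);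
* a product `mul i j` (model: `χ_iχ_j` to the modulus `q_iq_j`) with `Q (mul i j) ≤ Q i Q j`, a
  predicate `Principal i j` (model: `χ_iχ_j = 1` on the ideals prime to `q_iq_j`), and `coeff₃ i j`:
  for `χ_iχ_j` non-principal, `Z L_i L_j L_{mul i j} = (s − 1)∑ a(n) n^{-s}`, `a ≥ 0`, `a(1) = 1`
  (MV p. 285: "the Dirichlet series coefficients of `ζ(s)f(s)` are non-negative";
  `SiegelProductCoefficients.lean` for `K = ℚ`);
* `L_one_le`: `|L(1, χ_i)| ≤ T(δ) (Q i)^δ` for every `δ > 0` (model: partial summation with the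
  twisted count bound, `≪ log Q`);
* `principal_case`: if `χ_iχ_j` is principal then `L(1, χ_i) ≥ D(δ)(Q_iQ_j)^{−δ} L(1, χ_j)` for
  every `δ > 0` (model: `χ_i`, `χ_j` then agree on the ideals prime to `q_iq_j`, so the two
  `L`-functions differ by the Euler factors at `P ∣ q_iq_j`, and `∏_{P∣𝔪}(1 − N P^{-1}) ≫_δ N𝔪^{−δ}`;
  for primitive characters this is "`χ = χ₁`", MV p. 285).

**Results** (`namespace SiegelFamilyData`, `D : SiegelFamilyData ι`):

* `re_L_pos_of_one_lt`, `re_L_one_pos`, `re_L_pos_of_zeroFree` — `L_i(σ) > 0` for `1 < σ ≤ 2`,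
  `L(1, χ_i) > 0`, and `L_i(1 − η) > 0` when `L_i` has no zero on `[1 − η, 1)` (intermediate values);
* `caseA` — no member has a real zero on `[1 − η, 1)`: `Z(1)L(1,χ_i) ≥ c_R η ((M_ZB + 1)Q_i^κ)^{−A_Rη}`
  (Estermann for `H = Z L_i`, `β = 1 − η`);
* `caseB` — `L_{j₁}(β₁) = 0`, `β₁ ∈ [1 − (R − 1)/2, 1)`, `χ_iχ_{j₁}` non-principal:
  `Z(1)L(1,χ_i)L(1,χ_{j₁})L(1,χ_iχ_{j₁}) ≥ c_R(1 − β₁)((M_ZB³ + 1)(Q_iQ_{j₁})^{2κ})^{−A_R(1 − β₁)}`;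
* **`siegel`**, `siegel_norm` — `∀ ε > 0, ∃ C > 0, ∀ i, C (Q i)^{−ε} ≤ Re L(1, χ_i) = ‖L(1, χ_i)‖`,
  with `η(ε) = min(η₀, (R − 1)/2, ε/(4A_Rκ + 1))`, `η₀` from the continuity of `Z` at `1`, and the
  classical (ineffective) case distinction.

## References

* H. L. Montgomery, R. C. Vaughan, *Multiplicative Number Theory I. Classical Theory*, CUP 2007,
  §11.2, Theorem 11.14 and its proof, pp. 284–285. [cite: MontgomeryVaughan2007, §11.2 Theorem 11.14]
* C. L. Siegel, *Über die Classenzahl quadratischer Zahlkörper*, Acta Arith. 1 (1935), 83–86. [folklore]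
* D. R. Heath-Brown, *Primes represented by `x³ + 2y³`*, Acta Math. 186 (2001), §9 p. 55 ("Mitsui's
  treatment employs the familiar arguments concerning Siegel zeros"). [cite: HeathBrownActa2001, §9 Lemma 9.4]

## Sanity check (scratch, not shipped)

The structure is inhabited: `ι = Unit`, `R = 3/2`, `U = univ`, `Z = ζ₁` (Mathlib's `riemannZeta₁`,
`|ζ₁| ≤ 21` on the disc by `EstermannDisc.norm_riemannZeta₁_le_of_mem_closedBall`, real on the real
axis by `riemannZeta_im_eq_zero_of_pos`, `(σ − 1)ζ(σ) > 0` for `σ > 1`), `L ≡ 1` with `a = 1`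
(`LSeries_one_eq_riemannZeta`), `Principal ≡ True`, elaborates with no further input. The instance
"quadratic Dirichlet characters" needs in addition only lemmas already in `SiegelTheorem.lean`,
`SiegelProductCoefficients.lean`, `SiegelAbelSummation.lean` (not repeated here).

## Mathlib / tree search

Tree: `EstermannDisc.estermann_lemma_disc` (the engine), `Siegel.siegel_theorem_quadratic`
(`SiegelTheorem.lean`, Dirichlet characters only: `DirichletCharacter.LFunction`, `zetaMul_nonneg`,
`factorsThrough_gcd` hard-wired), `TwistedZFRData` (`TwistedZeroFreeRegion.lean`, the same
axiomatisation style for MV Theorem 11.3); `lean search 'siegel.*Family|SiegelFamily|abstract.*Siegel'`: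
nothing. Mathlib: `intermediate_value_Icc`, `LSeries.term_nonneg`, `le_hasSum`, `Real.mul_rpow`,
`Real.rpow_le_rpow_of_exponent_le`.
-/

noncomputable section

open Complex Filter Topology Set Metric
open scoped ComplexOrder

namespace Literature.NumberTheory.LFunctions

/-- **The data of Siegel's theorem** for a family of "real characters" `i : ι` with sizes `Q i ≥ 1`
and `L`-functions `L i`, relative to a zeta-like factor `Z(s) = (s − 1)ζ_K(s)`, on the disc
`|s − 2| ≤ R` (`1 < R ≤ 3/2`). See the module docstring for the meaning of each field and the
models (`K = ℚ`: Dirichlet characters; `K` a number field: real ray-class/Hecke characters).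
[cite: MontgomeryVaughan2007, §11.2 Theorem 11.14 (proof)] -/
structure SiegelFamilyData (ι : Type*) where
  /-- radius of the disc around `2` -/
  R : ℝ
  one_lt_R : 1 < R
  R_le : R ≤ 3 / 2
  /-- an open set containing the closed disc on which everything is holomorphic -/
  U : Set ℂ
  isOpen_U : IsOpen U
  closedBall_subset : closedBall (2 : ℂ) R ⊆ U
  /-- the zeta-like factor `Z(s) = (s − 1) ζ_K(s)` -/
  Z : ℂ → ℂ
  differentiableOn_Z : DifferentiableOn ℂ Z U
  /-- a bound for `|Z|` on the closed disc -/
  MZ : ℝ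
  norm_Z_le : ∀ s ∈ closedBall (2 : ℂ) R, ‖Z s‖ ≤ MZ
  Z_im : ∀ σ : ℝ, (σ : ℂ) ∈ closedBall (2 : ℂ) R → (Z σ).im = 0
  Z_one_pos : 0 < (Z 1).re
  Z_pos : ∀ σ : ℝ, 1 < σ → σ ≤ 2 → 0 < (Z σ).re
  /-- the size (conductor) of each member -/
  Q : ι → ℝ
  one_le_Q : ∀ i, 1 ≤ Q i
  /-- the `L`-function of each member (already continued to `U`) -/
  L : ι → ℂ → ℂ
  differentiableOn_L : ∀ i, DifferentiableOn ℂ (L i) U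
  /-- the polynomial bound `|L i| ≤ B (Q i)^κ` on the closed disc -/
  B : ℝ
  κ : ℝ
  B_nonneg : 0 ≤ B
  κ_nonneg : 0 ≤ κ
  norm_L_le : ∀ i, ∀ s ∈ closedBall (2 : ℂ) R, ‖L i s‖ ≤ B * Q i ^ κ
  L_im : ∀ i (σ : ℝ), (σ : ℂ) ∈ closedBall (2 : ℂ) R → (L i σ).im = 0
  /-- **non-vanishing at `s = 1`** (the one deep input) -/
  L_one_ne : ∀ i, L i 1 ≠ 0
  /-- `Z · L i` is `(s − 1)` times a Dirichlet series with non-negative coefficients, `a(1) = 1` -/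
  coeff₁ : ∀ i, ∃ a : ℕ → ℂ, 0 ≤ a ∧ a 1 = 1 ∧ (∀ s : ℂ, 1 < s.re → LSeriesSummable a s) ∧
    ∀ s : ℂ, 1 < s.re → Z s * L i s = (s - 1) * LSeries a s
  /-- the product character `χ_i χ_j` as a member of the family -/
  mul : ι → ι → ι
  /-- "`χ_i χ_j` is principal" -/
  Principal : ι → ι → Prop
  Q_mul_le : ∀ i j, Q (mul i j) ≤ Q i * Q j
  /-- for `χ_i χ_j` non-principal, `Z · L i · L j · L (mul i j)` has non-negative coefficients -/
  coeff₃ : ∀ i j, ¬ Principal i j → ∃ a : ℕ → ℂ, 0 ≤ a ∧ a 1 = 1 ∧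
    (∀ s : ℂ, 1 < s.re → LSeriesSummable a s) ∧
    ∀ s : ℂ, 1 < s.re → Z s * (L i s * L j s * L (mul i j) s) = (s - 1) * LSeries a s
  /-- `|L(1, χ_i)| ≪_δ (Q i)^δ` for every `δ > 0` -/
  L_one_le : ∀ δ : ℝ, 0 < δ → ∃ T : ℝ, ∀ i, ‖L i 1‖ ≤ T * Q i ^ δ
  /-- for `χ_i χ_j` principal, `L(1, χ_i) ≫_δ (Q i Q j)^{-δ} L(1, χ_j)` -/
  principal_case : ∀ δ : ℝ, 0 < δ → ∃ D : ℝ, 0 < D ∧ ∀ i j, Principal i j →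
    D * (Q i * Q j) ^ (-δ) * (L j 1).re ≤ (L i 1).re

/-! ### Generic lemmas -/

/-- A real-on-the-axis function, continuous and zero-free on `[u, v]` and positive at `v`, is
positive at `u` (intermediate value theorem). [folklore] -/
theorem re_pos_of_forall_ne_zero {f : ℂ → ℂ} {u v : ℝ} (huv : u ≤ v)
    (hcont : ContinuousOn (fun σ : ℝ => f σ) (Icc u v)) (him : ∀ σ ∈ Icc u v, (f σ).im = 0)
    (hne : ∀ σ ∈ Icc u v, f σ ≠ 0) (hv : 0 < (f v).re) : 0 < (f u).re := by
  by_contra h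
  push Not at h
  have hg : ContinuousOn (fun σ : ℝ => (f σ).re) (Icc u v) := continuous_re.comp_continuousOn hcont
  have hmem : (0 : ℝ) ∈ Icc ((fun σ : ℝ => (f σ).re) u) ((fun σ : ℝ => (f σ).re) v) := ⟨h, hv.le⟩
  obtain ⟨c, hc, hc0⟩ := intermediate_value_Icc huv hg hmem
  exact hne c hc (Complex.ext (by simpa using hc0) (by simpa using him c hc))

/-- `Re ∑ a(n) n^{-σ} ≥ 1` for `a ≥ 0`, `a(1) = 1`, `σ` real in the domain of absolute convergence.
[folklore] -/
theorem one_le_re_LSeries_ofReal {a : ℕ → ℂ} (ha : 0 ≤ a) (ha1 : a 1 = 1) {σ : ℝ}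
    (hsum : LSeriesSummable a σ) : 1 ≤ (LSeries a σ).re := by
  have hs : HasSum (fun n => LSeries.term a σ n) (LSeries a σ) := hsum.LSeriesHasSum
  have hle : LSeries.term a σ 1 ≤ LSeries a σ :=
    le_hasSum hs 1 fun j _ => LSeries.term_nonneg (ha j) σ
  have h1 : LSeries.term a σ 1 = 1 := by simp [LSeries.term, ha1]
  rw [h1] at hle
  have := (Complex.le_def.mp hle).1
  simpa using this

/-- `Q^{-b} ≤ Q^{-a}` for `Q ≥ 1`, `a ≤ b`. [folklore] -/
theorem rpow_neg_le_rpow_neg {Q a b : ℝ} (hQ : 1 ≤ Q) (hab : a ≤ b) : Q ^ (-b) ≤ Q ^ (-a) :=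
  Real.rpow_le_rpow_of_exponent_le hQ (by linarith)

namespace SiegelFamilyData

variable {ι : Type*} (D : SiegelFamilyData ι)

/-! ### Elementary consequences of the data -/

/-- Real points of `[1 − (R − 1)/2, 2]` lie in the closed disc `|s − 2| ≤ R`. [folklore] -/
theorem ofReal_mem_closedBall {σ : ℝ} (h1 : 1 - (D.R - 1) / 2 ≤ σ) (h2 : σ ≤ 2) :
    (σ : ℂ) ∈ closedBall (2 : ℂ) D.R := by
  have hR := D.one_lt_R
  rw [mem_closedBall, dist_eq_norm, show (σ : ℂ) - 2 = ((σ - 2 : ℝ) : ℂ) by push_cast; ring,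
    norm_real, Real.norm_eq_abs, abs_sub_comm, abs_of_nonneg (by linarith)]
  linarith

/-- `1 ∈ U`. [folklore] -/
theorem one_mem_U : (1 : ℂ) ∈ D.U :=
  D.closedBall_subset (EstermannDisc.one_mem_closedBall D.one_lt_R.le)

/-- `MZ ≥ 0`. [folklore] -/
theorem MZ_nonneg : 0 ≤ D.MZ :=
  (norm_nonneg _).trans (D.norm_Z_le 2 (mem_closedBall_self (by linarith [D.one_lt_R])))

/-- `σ ↦ L_i(σ)` is continuous on `[u, v] ⊆ [1 − (R − 1)/2, 2]`. [folklore] -/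
theorem continuousOn_L_ofReal (i : ι) {u v : ℝ} (hu : 1 - (D.R - 1) / 2 ≤ u) (hv : v ≤ 2) :
    ContinuousOn (fun σ : ℝ => D.L i σ) (Icc u v) := by
  refine (D.differentiableOn_L i).continuousOn.comp continuous_ofReal.continuousOn fun σ hσ => ?_
  exact D.closedBall_subset (D.ofReal_mem_closedBall (hu.trans hσ.1) (hσ.2.trans hv))

/-- **`L_i(σ) > 0` for `1 < σ ≤ 2`**: `Z(σ)L_i(σ) = (σ − 1)∑ a(n)n^{-σ} ≥ σ − 1 > 0` with `Z(σ) > 0`,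
both factors real. [cite: MontgomeryVaughan2007, §11.2 p. 285] -/
theorem re_L_pos_of_one_lt (i : ι) {σ : ℝ} (h1 : 1 < σ) (h2 : σ ≤ 2) : 0 < (D.L i σ).re := by
  obtain ⟨a, ha, ha1, hsum, hL⟩ := D.coeff₁ i
  have hR := D.one_lt_R
  have hmem : (σ : ℂ) ∈ closedBall (2 : ℂ) D.R := D.ofReal_mem_closedBall (by linarith) h2
  have hZim := D.Z_im σ hmem
  have hLim := D.L_im i σ hmem
  have hZre := D.Z_pos σ h1 h2
  have hσ' : 1 < (σ : ℂ).re := by simpa using h1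
  have key := congrArg Complex.re (hL σ hσ')
  rw [mul_re, hZim, hLim, mul_zero, sub_zero] at key
  have hS : 1 ≤ (LSeries a σ).re := one_le_re_LSeries_ofReal ha ha1 (hsum σ hσ')
  have hrhs : ((σ : ℂ) - 1) * LSeries a σ = ((σ - 1 : ℝ) : ℂ) * LSeries a σ := by push_cast; ring
  rw [hrhs, re_ofReal_mul] at key
  have hpos : 0 < (σ - 1) * (LSeries a σ).re := mul_pos (by linarith) (by linarith)
  rw [← key] at hpos
  exact (mul_pos_iff_of_pos_left hZre).mp hpos

/-- `L_i(σ) ≠ 0` for `1 < σ ≤ 2`. [folklore] -/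
theorem L_ofReal_ne_zero_of_one_lt (i : ι) {σ : ℝ} (h1 : 1 < σ) (h2 : σ ≤ 2) : D.L i σ ≠ 0 := by
  intro h
  have := D.re_L_pos_of_one_lt i h1 h2
  rw [h, zero_re] at this
  exact lt_irrefl _ this

/-- **`L(1, χ_i) > 0`** (real, non-zero on `[1, 2]`, positive at `2`). [cite: MontgomeryVaughan2007, §11.2 p. 285] -/
theorem re_L_one_pos (i : ι) : 0 < (D.L i 1).re := by
  have hR := D.one_lt_R
  have h := re_pos_of_forall_ne_zero (f := D.L i) (u := 1) (v := 2) one_le_two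
    (D.continuousOn_L_ofReal i (by linarith) le_rfl)
    (fun σ hσ => D.L_im i σ (D.ofReal_mem_closedBall (by linarith [hσ.1]) hσ.2))
    (fun σ hσ => ?_) (by simpa using D.re_L_pos_of_one_lt i one_lt_two le_rfl)
  · simpa using h
  · rcases eq_or_lt_of_le hσ.1 with h1 | h1
    · rw [← h1, ofReal_one]; exact D.L_one_ne i
    · exact D.L_ofReal_ne_zero_of_one_lt i h1 hσ.2

/-- `Re L(1, χ_i) = |L(1, χ_i)|`. [folklore] -/
theorem re_L_one_eq_norm (i : ι) : (D.L i 1).re = ‖D.L i 1‖ := by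
  have him : (D.L i 1).im = 0 := by
    have := D.L_im i 1 (by simpa using EstermannDisc.one_mem_closedBall D.one_lt_R.le)
    simpa using this
  have hz : D.L i 1 = ((D.L i 1).re : ℂ) := Complex.ext (by simp) (by simp [him])
  rw [hz, Complex.norm_real, Real.norm_eq_abs, ofReal_re, abs_of_nonneg (D.re_L_one_pos i).le]

/-- **`L_i(1 − η) > 0` in the zero-free case**: if `L_i` has no zero on `[1 − η, 1)`
(`0 < η ≤ (R − 1)/2`), then `Re L_i(1 − η) > 0`. [cite: MontgomeryVaughan2007, §11.2 p. 285] -/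
theorem re_L_pos_of_zeroFree (i : ι) {η : ℝ} (hη : 0 < η) (hηR : η ≤ (D.R - 1) / 2)
    (hz : ∀ β : ℝ, 1 - η ≤ β → β < 1 → D.L i β ≠ 0) : 0 < (D.L i (1 - η : ℝ)).re := by
  have hR := D.one_lt_R
  refine re_pos_of_forall_ne_zero (f := D.L i) (u := 1 - η) (v := 2) (by linarith)
    (D.continuousOn_L_ofReal i (by linarith) le_rfl)
    (fun σ hσ => D.L_im i σ (D.ofReal_mem_closedBall (by linarith [hσ.1]) hσ.2))
    (fun σ hσ => ?_) (by simpa using D.re_L_pos_of_one_lt i one_lt_two le_rfl)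
  rcases lt_trichotomy σ 1 with h1 | rfl | h1
  · exact hz σ hσ.1 h1
  · rw [ofReal_one]; exact D.L_one_ne i
  · exact D.L_ofReal_ne_zero_of_one_lt i h1 hσ.2

/-- **`Z(σ) > 0` near `σ = 1`** (continuity at `1` and `Z(1) > 0`). [folklore] -/
theorem exists_Z_re_pos : ∃ η₀ : ℝ, 0 < η₀ ∧ ∀ σ : ℝ, |σ - 1| ≤ η₀ → 0 < (D.Z σ).re := by
  have hcont : ContinuousAt D.Z 1 :=
    (D.differentiableOn_Z.differentiableAt (D.isOpen_U.mem_nhds D.one_mem_U)).continuousAt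
  have hre : ContinuousAt (fun s => (D.Z s).re) 1 := continuous_re.continuousAt.comp hcont
  have hev : ∀ᶠ s in 𝓝 (1 : ℂ), (D.Z s).re ∈ Ioi (0 : ℝ) :=
    hre.eventually_mem (Ioi_mem_nhds D.Z_one_pos)
  obtain ⟨r, hr, hball⟩ := Metric.eventually_nhds_iff.mp hev
  refine ⟨r / 2, by positivity, fun σ hσ => hball ?_⟩
  rw [dist_eq_norm, show (σ : ℂ) - 1 = ((σ - 1 : ℝ) : ℂ) by push_cast; ring, norm_real,
    Real.norm_eq_abs]
  linarith

/-! ### Case A: no exceptional zero -/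

/-- **MV Theorem 11.14, Case A** (no member has a real zero on `[1 − η, 1)`): Estermann's lemma for
`H = Z · L_i` at `β = 1 − η` gives `Re L(1, χ_i) ≥ c_R η ((M_Z B + 1)Q_i^κ)^{−A_R η}/Z(1)`, for
`0 < η ≤ (R − 1)/2` with `Z > 0` on `[1 − η, 1]`. [cite: MontgomeryVaughan2007, §11.2 Theorem 11.14, p. 285] -/
theorem caseA {η : ℝ} (hη : 0 < η) (hηR : η ≤ (D.R - 1) / 2)
    (hηZ : ∀ σ : ℝ, |σ - 1| ≤ η → 0 < (D.Z σ).re)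
    (hz : ∀ j (β : ℝ), 1 - η ≤ β → β < 1 → D.L j β ≠ 0) (i : ι) :
    EstermannDisc.discC D.R * η * ((D.MZ * D.B + 1) * D.Q i ^ D.κ) ^ (-(EstermannDisc.discA D.R * η)) ≤
      (D.Z 1).re * (D.L i 1).re := by
  have hR := D.one_lt_R
  have hQ1 := D.one_le_Q i
  have hQκ : 1 ≤ D.Q i ^ D.κ := Real.one_le_rpow hQ1 D.κ_nonneg
  have hMZ := D.MZ_nonneg
  have hB := D.B_nonneg
  set M : ℝ := (D.MZ * D.B + 1) * D.Q i ^ D.κ with hMdef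
  have hM1 : 1 ≤ M := by
    have : 1 ≤ D.MZ * D.B + 1 := by nlinarith
    exact one_le_mul_of_one_le_of_one_le this hQκ
  obtain ⟨a, ha, ha1, hsum, hL⟩ := D.coeff₁ i
  set H : ℂ → ℂ := fun s => D.Z s * D.L i s with hHdef
  have hH : DifferentiableOn ℂ H D.U := D.differentiableOn_Z.mul (D.differentiableOn_L i)
  have hHM : ∀ s ∈ closedBall (2 : ℂ) D.R, ‖H s‖ ≤ M := by
    intro s hs
    have h1 := D.norm_Z_le s hs
    have h2 := D.norm_L_le i s hs
    calc ‖H s‖ = ‖D.Z s‖ * ‖D.L i s‖ := norm_mul _ _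
      _ ≤ D.MZ * (D.B * D.Q i ^ D.κ) := by gcongr
      _ ≤ M := by rw [hMdef]; nlinarith
  have hL' : ∀ s : ℂ, 1 < s.re → H s = (s - 1) * LSeries a s := fun s hs => hL s hs
  -- positivity of `H(1 − η) = Z(1 − η) L_i(1 − η)`
  have hmem : ((1 - η : ℝ) : ℂ) ∈ closedBall (2 : ℂ) D.R := D.ofReal_mem_closedBall (by linarith) (by linarith)
  have hZim := D.Z_im (1 - η) hmem
  have hLim := D.L_im i (1 - η) hmem
  have hZre : 0 < (D.Z (1 - η : ℝ)).re := hηZ (1 - η) (by rw [show (1 - η - 1 : ℝ) = -η by ring, abs_neg, abs_of_pos hη])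
  have hLre : 0 < (D.L i (1 - η : ℝ)).re := D.re_L_pos_of_zeroFree i hη hηR (hz i)
  have hHβ : 0 ≤ (H (1 - η : ℝ)).re := by
    simp only [hHdef, mul_re, hZim, hLim, mul_zero, sub_zero]
    exact (mul_pos hZre hLre).le
  have key := EstermannDisc.estermann_lemma_disc D.one_lt_R D.R_le D.isOpen_U D.closedBall_subset hH
    hM1 hHM ha ha1 hsum hL' (β := 1 - η) (by linarith) (by linarith) hHβ
  have e : 1 - (1 - η) = η := by ring
  rw [e] at key
  -- `Re H(1) = Z(1) L_i(1)` (both real)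
  have hZim1 : (D.Z 1).im = 0 := by
    simpa using D.Z_im 1 (by simpa using EstermannDisc.one_mem_closedBall hR.le)
  have hLim1 : (D.L i 1).im = 0 := by
    simpa using D.L_im i 1 (by simpa using EstermannDisc.one_mem_closedBall hR.le)
  have hH1 : (H 1).re = (D.Z 1).re * (D.L i 1).re := by
    simp only [hHdef, mul_re, hZim1, hLim1, mul_zero, sub_zero]
  rw [hH1] at key
  exact key

/-! ### Case B: an exceptional zero -/

/-- **MV Theorem 11.14, Case B** (some `L_{j₁}` has a real zero `β₁ ∈ [1 − (R−1)/2, 1)`): for `χ_iχ_{j₁}`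
non-principal, Estermann's lemma for `H = Z · L_i L_{j₁} L_{i j₁}` at `β = β₁` gives
`Z(1) Re(L_i L_{j₁} L_{ij₁})(1) ≥ c_R (1 − β₁) ((M_Z B³ + 1)(Q_iQ_{j₁})^{2κ})^{−A_R(1 − β₁)}`.
[cite: MontgomeryVaughan2007, §11.2 Theorem 11.14, p. 285] -/
theorem caseB {j₁ : ι} {β₁ : ℝ} (hβ₁ : 1 - (D.R - 1) / 2 ≤ β₁) (hβ₁1 : β₁ < 1)
    (hzero : D.L j₁ β₁ = 0) {i : ι} (hp : ¬ D.Principal i j₁) :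
    EstermannDisc.discC D.R * (1 - β₁) *
        ((D.MZ * D.B ^ 3 + 1) * (D.Q i * D.Q j₁) ^ (2 * D.κ)) ^ (-(EstermannDisc.discA D.R * (1 - β₁))) ≤
      (D.Z 1).re * ((D.L i 1).re * (D.L j₁ 1).re * (D.L (D.mul i j₁) 1).re) := by
  have hR := D.one_lt_R
  have hQi := D.one_le_Q i
  have hQj := D.one_le_Q j₁
  have hQij : 1 ≤ D.Q i * D.Q j₁ := one_le_mul_of_one_le_of_one_le hQi hQj
  have hκ := D.κ_nonneg
  have hMZ := D.MZ_nonneg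
  have hB := D.B_nonneg
  set M : ℝ := (D.MZ * D.B ^ 3 + 1) * (D.Q i * D.Q j₁) ^ (2 * D.κ) with hMdef
  have hpow1 : 1 ≤ (D.Q i * D.Q j₁) ^ (2 * D.κ) := Real.one_le_rpow hQij (by linarith)
  have hM1 : 1 ≤ M := by
    have : 1 ≤ D.MZ * D.B ^ 3 + 1 := by nlinarith [pow_nonneg hB 3]
    exact one_le_mul_of_one_le_of_one_le this hpow1
  obtain ⟨a, ha, ha1, hsum, hL⟩ := D.coeff₃ i j₁ hp
  set H : ℂ → ℂ := fun s => D.Z s * (D.L i s * D.L j₁ s * D.L (D.mul i j₁) s) with hHdef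
  have hH : DifferentiableOn ℂ H D.U :=
    D.differentiableOn_Z.mul (((D.differentiableOn_L i).mul (D.differentiableOn_L j₁)).mul
      (D.differentiableOn_L _))
  -- the bound on the disc
  have hQprod : D.Q i ^ D.κ * D.Q j₁ ^ D.κ * D.Q (D.mul i j₁) ^ D.κ ≤ (D.Q i * D.Q j₁) ^ (2 * D.κ) := by
    have h1 : D.Q (D.mul i j₁) ^ D.κ ≤ (D.Q i * D.Q j₁) ^ D.κ :=
      Real.rpow_le_rpow (by linarith [D.one_le_Q (D.mul i j₁)]) (D.Q_mul_le i j₁) hκ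
    have h2 : D.Q i ^ D.κ * D.Q j₁ ^ D.κ = (D.Q i * D.Q j₁) ^ D.κ :=
      (Real.mul_rpow (by linarith) (by linarith)).symm
    have h3 : (D.Q i * D.Q j₁) ^ (2 * D.κ) = (D.Q i * D.Q j₁) ^ D.κ * (D.Q i * D.Q j₁) ^ D.κ := by
      rw [two_mul, Real.rpow_add (by linarith)]
    rw [h2, h3]
    exact mul_le_mul_of_nonneg_left h1 (Real.rpow_nonneg (by linarith) _)
  have hHM : ∀ s ∈ closedBall (2 : ℂ) D.R, ‖H s‖ ≤ M := by
    intro s hs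
    have h0 := D.norm_Z_le s hs
    have h1 := D.norm_L_le i s hs
    have h2 := D.norm_L_le j₁ s hs
    have h3 := D.norm_L_le (D.mul i j₁) s hs
    have hQm0 : 0 < D.Q (D.mul i j₁) := by linarith [D.one_le_Q (D.mul i j₁)]
    have hQi0 : 0 < D.Q i := by linarith
    have hQj0 : 0 < D.Q j₁ := by linarith
    have hK : 0 ≤ D.Q i ^ D.κ * D.Q j₁ ^ D.κ * D.Q (D.mul i j₁) ^ D.κ :=
      mul_nonneg (mul_nonneg (Real.rpow_nonneg hQi0.le _) (Real.rpow_nonneg hQj0.le _))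
        (Real.rpow_nonneg hQm0.le _)
    calc ‖H s‖ = ‖D.Z s‖ * (‖D.L i s‖ * ‖D.L j₁ s‖ * ‖D.L (D.mul i j₁) s‖) := by
          simp only [hHdef, norm_mul]
      _ ≤ D.MZ * ((D.B * D.Q i ^ D.κ) * (D.B * D.Q j₁ ^ D.κ) * (D.B * D.Q (D.mul i j₁) ^ D.κ)) := by
          gcongr
      _ = D.MZ * D.B ^ 3 * (D.Q i ^ D.κ * D.Q j₁ ^ D.κ * D.Q (D.mul i j₁) ^ D.κ) := by ring
      _ ≤ (D.MZ * D.B ^ 3 + 1) * (D.Q i * D.Q j₁) ^ (2 * D.κ) := by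
          have : 0 ≤ D.MZ * D.B ^ 3 := by positivity
          nlinarith
  have hL' : ∀ s : ℂ, 1 < s.re → H s = (s - 1) * LSeries a s := fun s hs => hL s hs
  have hHβ : 0 ≤ (H β₁).re := by
    simp [hHdef, hzero]
  have key := EstermannDisc.estermann_lemma_disc D.one_lt_R D.R_le D.isOpen_U D.closedBall_subset hH
    hM1 hHM ha ha1 hsum hL' hβ₁ hβ₁1 hHβ
  -- `Re H(1)` as a product of real numbers
  have h1mem : ((1 : ℝ) : ℂ) ∈ closedBall (2 : ℂ) D.R := by
    simpa using EstermannDisc.one_mem_closedBall hR.le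
  have hZim1 : (D.Z 1).im = 0 := by simpa using D.Z_im 1 h1mem
  have hLi : (D.L i 1).im = 0 := by simpa using D.L_im i 1 h1mem
  have hLj : (D.L j₁ 1).im = 0 := by simpa using D.L_im j₁ 1 h1mem
  have hLm : (D.L (D.mul i j₁) 1).im = 0 := by simpa using D.L_im (D.mul i j₁) 1 h1mem
  have hH1 : (H 1).re = (D.Z 1).re * ((D.L i 1).re * (D.L j₁ 1).re * (D.L (D.mul i j₁) 1).re) := by
    simp only [hHdef, mul_re, mul_im, hZim1, hLi, hLj, hLm, mul_zero, zero_mul, sub_zero, add_zero]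
  rw [hH1] at key
  exact key

/-! ### Siegel's theorem: the three bounds -/

/-- **Case A, final form**: under the hypotheses of `caseA` and `κ A_R η ≤ ε`,
`(c_R η (M_ZB + 1)^{−A_Rη}/Z(1)) · Q_i^{−ε} ≤ Re L(1, χ_i)`. [cite: MontgomeryVaughan2007, §11.2 Theorem 11.14, p. 285] -/
theorem caseA_bound {ε η : ℝ} (hη : 0 < η) (hηR : η ≤ (D.R - 1) / 2)
    (hηε : D.κ * EstermannDisc.discA D.R * η ≤ ε)
    (hηZ : ∀ σ : ℝ, |σ - 1| ≤ η → 0 < (D.Z σ).re)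
    (hz : ∀ j (β : ℝ), 1 - η ≤ β → β < 1 → D.L j β ≠ 0) (i : ι) :
    EstermannDisc.discC D.R * η * (D.MZ * D.B + 1) ^ (-(EstermannDisc.discA D.R * η)) / (D.Z 1).re *
        D.Q i ^ (-ε) ≤ (D.L i 1).re := by
  have hMZ := D.MZ_nonneg
  have hB := D.B_nonneg
  have hZ1 := D.Z_one_pos
  have hQi := D.one_le_Q i
  have hQi0 : 0 < D.Q i := by linarith
  have hc : 0 < EstermannDisc.discC D.R := EstermannDisc.discC_pos
  have key := D.caseA hη hηR hηZ hz i
  have hbase : 0 < D.MZ * D.B + 1 := by positivity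
  have hsplit : ((D.MZ * D.B + 1) * D.Q i ^ D.κ) ^ (-(EstermannDisc.discA D.R * η)) =
      (D.MZ * D.B + 1) ^ (-(EstermannDisc.discA D.R * η)) *
        D.Q i ^ (-(D.κ * EstermannDisc.discA D.R * η)) := by
    have e : D.κ * -(EstermannDisc.discA D.R * η) = -(D.κ * EstermannDisc.discA D.R * η) := by ring
    rw [Real.mul_rpow hbase.le (Real.rpow_nonneg hQi0.le _), ← Real.rpow_mul hQi0.le, e]
  have hmono : D.Q i ^ (-ε) ≤ D.Q i ^ (-(D.κ * EstermannDisc.discA D.R * η)) :=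
    rpow_neg_le_rpow_neg hQi hηε
  have hK₁ : 0 < (D.MZ * D.B + 1) ^ (-(EstermannDisc.discA D.R * η)) := Real.rpow_pos_of_pos hbase _
  rw [hsplit] at key
  rw [div_mul_eq_mul_div, div_le_iff₀ hZ1]
  calc EstermannDisc.discC D.R * η * (D.MZ * D.B + 1) ^ (-(EstermannDisc.discA D.R * η)) * D.Q i ^ (-ε)
      ≤ EstermannDisc.discC D.R * η * (D.MZ * D.B + 1) ^ (-(EstermannDisc.discA D.R * η)) *
          D.Q i ^ (-(D.κ * EstermannDisc.discA D.R * η)) := by gcongr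
    _ = EstermannDisc.discC D.R * η * ((D.MZ * D.B + 1) ^ (-(EstermannDisc.discA D.R * η)) *
          D.Q i ^ (-(D.κ * EstermannDisc.discA D.R * η))) := by ring
    _ ≤ (D.Z 1).re * (D.L i 1).re := key
    _ = (D.L i 1).re * (D.Z 1).re := mul_comm _ _

/-- **Case B, principal products**: if `χ_iχ_{j₁}` is principal then
`(D(ε/2) Q_{j₁}^{−ε/2} L(1, χ_{j₁})) · Q_i^{−ε} ≤ Re L(1, χ_i)`. [cite: MontgomeryVaughan2007, §11.2 Theorem 11.14, p. 285] -/
theorem caseB_principal_bound {ε Dp : ℝ} (hε : 0 < ε) (hDp : 0 < Dp)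
    (hprin : ∀ i j, D.Principal i j → Dp * (D.Q i * D.Q j) ^ (-(ε / 2)) * (D.L j 1).re ≤ (D.L i 1).re)
    {i j₁ : ι} (hp : D.Principal i j₁) :
    Dp * D.Q j₁ ^ (-(ε / 2)) * (D.L j₁ 1).re * D.Q i ^ (-ε) ≤ (D.L i 1).re := by
  have hQi := D.one_le_Q i
  have hQj := D.one_le_Q j₁
  have hQi0 : 0 < D.Q i := by linarith
  have hQj0 : 0 < D.Q j₁ := by linarith
  have hℓ₁ : 0 < (D.L j₁ 1).re := D.re_L_one_pos j₁
  have h := hprin i j₁ hp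
  rw [Real.mul_rpow hQi0.le hQj0.le] at h
  have hmono : D.Q i ^ (-ε) ≤ D.Q i ^ (-(ε / 2)) := rpow_neg_le_rpow_neg hQi (by linarith)
  have hC : 0 ≤ Dp * D.Q j₁ ^ (-(ε / 2)) * (D.L j₁ 1).re :=
    mul_nonneg (mul_nonneg hDp.le (Real.rpow_nonneg hQj0.le _)) hℓ₁.le
  calc Dp * D.Q j₁ ^ (-(ε / 2)) * (D.L j₁ 1).re * D.Q i ^ (-ε)
      ≤ Dp * D.Q j₁ ^ (-(ε / 2)) * (D.L j₁ 1).re * D.Q i ^ (-(ε / 2)) :=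
        mul_le_mul_of_nonneg_left hmono hC
    _ = Dp * (D.Q i ^ (-(ε / 2)) * D.Q j₁ ^ (-(ε / 2))) * (D.L j₁ 1).re := by ring
    _ ≤ (D.L i 1).re := h

/-- **Case B, non-principal products, final form**: with `L_{j₁}(β₁) = 0`, `1 − η ≤ β₁ < 1`,
`η ≤ (R − 1)/2`, `4κA_Rη ≤ ε`, and `|L(1, χ_j)| ≤ T' Q_j^{ε/2}` for all `j`:
`C_B · Q_i^{−ε} ≤ Re L(1, χ_i)` with
`C_B = c_R(1 − β₁)(M_ZB³ + 1)^{−A_Rη} Q_{j₁}^{−ε}/(Z(1) L(1,χ_{j₁}) T')`.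
[cite: MontgomeryVaughan2007, §11.2 Theorem 11.14, p. 285] -/
theorem caseB_bound {ε η : ℝ} (hε : 0 < ε) (hηR : η ≤ (D.R - 1) / 2)
    (hηε : 4 * D.κ * EstermannDisc.discA D.R * η ≤ ε)
    {j₁ : ι} {β₁ : ℝ} (hβ₁ : 1 - η ≤ β₁) (hβ₁1 : β₁ < 1) (hzero : D.L j₁ β₁ = 0)
    {T' : ℝ} (hT'0 : 0 < T') (hT' : ∀ j, ‖D.L j 1‖ ≤ T' * D.Q j ^ (ε / 2))
    {i : ι} (hp : ¬ D.Principal i j₁) :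
    EstermannDisc.discC D.R * (1 - β₁) * (D.MZ * D.B ^ 3 + 1) ^ (-(EstermannDisc.discA D.R * η)) *
        D.Q j₁ ^ (-ε) / ((D.Z 1).re * (D.L j₁ 1).re * T') * D.Q i ^ (-ε) ≤ (D.L i 1).re := by
  have hMZ := D.MZ_nonneg
  have hB := D.B_nonneg
  have hκ := D.κ_nonneg
  have hZ1 := D.Z_one_pos
  have hA : 0 < EstermannDisc.discA D.R := EstermannDisc.discA_pos D.one_lt_R
  have hc : 0 < EstermannDisc.discC D.R := EstermannDisc.discC_pos
  have hQi := D.one_le_Q i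
  have hQj := D.one_le_Q j₁
  have hQi0 : 0 < D.Q i := by linarith
  have hQj0 : 0 < D.Q j₁ := by linarith
  have hQij : 1 ≤ D.Q i * D.Q j₁ := one_le_mul_of_one_le_of_one_le hQi hQj
  have hQij0 : 0 < D.Q i * D.Q j₁ := by linarith
  have h1β : 0 < 1 - β₁ := by linarith
  have hℓ₁ : 0 < (D.L j₁ 1).re := D.re_L_one_pos j₁
  have hℓi : 0 < (D.L i 1).re := D.re_L_one_pos i
  have hℓm : 0 < (D.L (D.mul i j₁) 1).re := D.re_L_one_pos _
  have key := D.caseB (by linarith) hβ₁1 hzero hp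
  -- upper bound for `L(1, χ_{i j₁})`
  have hm_le : (D.L (D.mul i j₁) 1).re ≤ T' * (D.Q i * D.Q j₁) ^ (ε / 2) := by
    rw [D.re_L_one_eq_norm]
    refine (hT' _).trans (mul_le_mul_of_nonneg_left ?_ hT'0.le)
    exact Real.rpow_le_rpow (by linarith [D.one_le_Q (D.mul i j₁)]) (D.Q_mul_le i j₁) (by linarith)
  -- lower bound for `M^{-A(1-β₁)}`
  have hbase : 0 < D.MZ * D.B ^ 3 + 1 := by positivity
  have hbase1 : 1 ≤ D.MZ * D.B ^ 3 + 1 := by nlinarith [pow_nonneg hB 3]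
  have hM1 : 1 ≤ (D.MZ * D.B ^ 3 + 1) * (D.Q i * D.Q j₁) ^ (2 * D.κ) :=
    one_le_mul_of_one_le_of_one_le hbase1 (Real.one_le_rpow hQij (by linarith))
  have hMpow : ((D.MZ * D.B ^ 3 + 1) * (D.Q i * D.Q j₁) ^ (2 * D.κ)) ^ (-(EstermannDisc.discA D.R * η)) ≤
      ((D.MZ * D.B ^ 3 + 1) * (D.Q i * D.Q j₁) ^ (2 * D.κ)) ^ (-(EstermannDisc.discA D.R * (1 - β₁))) :=
    rpow_neg_le_rpow_neg hM1 (by nlinarith)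
  have hMsplit : ((D.MZ * D.B ^ 3 + 1) * (D.Q i * D.Q j₁) ^ (2 * D.κ)) ^ (-(EstermannDisc.discA D.R * η)) =
      (D.MZ * D.B ^ 3 + 1) ^ (-(EstermannDisc.discA D.R * η)) *
        (D.Q i * D.Q j₁) ^ (-(2 * D.κ * EstermannDisc.discA D.R * η)) := by
    have e : 2 * D.κ * -(EstermannDisc.discA D.R * η) = -(2 * D.κ * EstermannDisc.discA D.R * η) := by
      ring
    rw [Real.mul_rpow hbase.le (Real.rpow_nonneg hQij0.le _), ← Real.rpow_mul hQij0.le, e]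
  have hQpow : (D.Q i * D.Q j₁) ^ (-(ε / 2)) ≤ (D.Q i * D.Q j₁) ^ (-(2 * D.κ * EstermannDisc.discA D.R * η)) :=
    rpow_neg_le_rpow_neg hQij (by nlinarith)
  have hK₀ : 0 < (D.MZ * D.B ^ 3 + 1) ^ (-(EstermannDisc.discA D.R * η)) := Real.rpow_pos_of_pos hbase _
  -- assemble
  have step1 : EstermannDisc.discC D.R * (1 - β₁) *
      ((D.MZ * D.B ^ 3 + 1) ^ (-(EstermannDisc.discA D.R * η)) * (D.Q i * D.Q j₁) ^ (-(ε / 2))) ≤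
      (D.Z 1).re * ((D.L i 1).re * (D.L j₁ 1).re * (T' * (D.Q i * D.Q j₁) ^ (ε / 2))) := by
    calc EstermannDisc.discC D.R * (1 - β₁) *
          ((D.MZ * D.B ^ 3 + 1) ^ (-(EstermannDisc.discA D.R * η)) * (D.Q i * D.Q j₁) ^ (-(ε / 2)))
        ≤ EstermannDisc.discC D.R * (1 - β₁) *
          ((D.MZ * D.B ^ 3 + 1) ^ (-(EstermannDisc.discA D.R * η)) *
            (D.Q i * D.Q j₁) ^ (-(2 * D.κ * EstermannDisc.discA D.R * η))) := by gcongr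
      _ = EstermannDisc.discC D.R * (1 - β₁) *
          ((D.MZ * D.B ^ 3 + 1) * (D.Q i * D.Q j₁) ^ (2 * D.κ)) ^ (-(EstermannDisc.discA D.R * η)) := by
          rw [hMsplit]
      _ ≤ EstermannDisc.discC D.R * (1 - β₁) *
          ((D.MZ * D.B ^ 3 + 1) * (D.Q i * D.Q j₁) ^ (2 * D.κ)) ^ (-(EstermannDisc.discA D.R * (1 - β₁))) := by
          gcongr
      _ ≤ (D.Z 1).re * ((D.L i 1).re * (D.L j₁ 1).re * (D.L (D.mul i j₁) 1).re) := key
      _ ≤ (D.Z 1).re * ((D.L i 1).re * (D.L j₁ 1).re * (T' * (D.Q i * D.Q j₁) ^ (ε / 2))) := by gcongr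
  have hsq : (D.Q i * D.Q j₁) ^ (-(ε / 2)) = (D.Q i * D.Q j₁) ^ (-ε) * (D.Q i * D.Q j₁) ^ (ε / 2) := by
    rw [← Real.rpow_add hQij0]; congr 1; ring
  have hprodε : (D.Q i * D.Q j₁) ^ (-ε) = D.Q i ^ (-ε) * D.Q j₁ ^ (-ε) := Real.mul_rpow hQi0.le hQj0.le
  have hpos1 : 0 < (D.Q i * D.Q j₁) ^ (ε / 2) := Real.rpow_pos_of_pos hQij0 _
  have hden : 0 < (D.Z 1).re * (D.L j₁ 1).re * T' := by positivity
  rw [hsq, hprodε] at step1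
  rw [div_mul_eq_mul_div, div_le_iff₀ hden]
  have h2 : EstermannDisc.discC D.R * (1 - β₁) * (D.MZ * D.B ^ 3 + 1) ^ (-(EstermannDisc.discA D.R * η)) *
        D.Q j₁ ^ (-ε) * D.Q i ^ (-ε) * (D.Q i * D.Q j₁) ^ (ε / 2) ≤
      (D.L i 1).re * ((D.Z 1).re * (D.L j₁ 1).re * T') * (D.Q i * D.Q j₁) ^ (ε / 2) := by
    have e1 : EstermannDisc.discC D.R * (1 - β₁) * (D.MZ * D.B ^ 3 + 1) ^ (-(EstermannDisc.discA D.R * η)) *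
          D.Q j₁ ^ (-ε) * D.Q i ^ (-ε) * (D.Q i * D.Q j₁) ^ (ε / 2) =
        EstermannDisc.discC D.R * (1 - β₁) * ((D.MZ * D.B ^ 3 + 1) ^ (-(EstermannDisc.discA D.R * η)) *
          (D.Q i ^ (-ε) * D.Q j₁ ^ (-ε) * (D.Q i * D.Q j₁) ^ (ε / 2))) := by ring
    have e2 : (D.L i 1).re * ((D.Z 1).re * (D.L j₁ 1).re * T') * (D.Q i * D.Q j₁) ^ (ε / 2) =
        (D.Z 1).re * ((D.L i 1).re * (D.L j₁ 1).re * (T' * (D.Q i * D.Q j₁) ^ (ε / 2))) := by ring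
    rw [e1, e2]; exact step1
  exact le_of_mul_le_mul_right h2 hpos1

/-! ### Siegel's theorem -/

/-- **Siegel's theorem, abstract form** (MV Theorem 11.14 for the family `D`): for every `ε > 0` there
is `C(ε) > 0` with `L(1, χ_i) ≥ C(ε) Q_i^{−ε}` for all `i`. The constant is ineffective: the proof
splits (classically) according to whether some member has a real zero on `[1 − η(ε), 1)`,
`η(ε) = min(η₀, (R − 1)/2, ε/(4A_Rκ + 1))`. [cite: MontgomeryVaughan2007, §11.2 Theorem 11.14, pp. 284–285] -/
theorem siegel {ε : ℝ} (hε : 0 < ε) : ∃ C : ℝ, 0 < C ∧ ∀ i, C * D.Q i ^ (-ε) ≤ (D.L i 1).re := by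
  have hR := D.one_lt_R
  have hκ := D.κ_nonneg
  have hMZ := D.MZ_nonneg
  have hB := D.B_nonneg
  have hA : 0 < EstermannDisc.discA D.R := EstermannDisc.discA_pos hR
  have hc : 0 < EstermannDisc.discC D.R := EstermannDisc.discC_pos
  have hZ1 := D.Z_one_pos
  obtain ⟨η₀, hη₀, hη₀Z⟩ := D.exists_Z_re_pos
  -- the choice of `η`
  have hden : 0 < 4 * EstermannDisc.discA D.R * D.κ + 1 := by positivity
  obtain ⟨η, hη, hηη₀, hηR, hηε⟩ : ∃ η : ℝ, 0 < η ∧ η ≤ η₀ ∧ η ≤ (D.R - 1) / 2 ∧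
      4 * D.κ * EstermannDisc.discA D.R * η ≤ ε := by
    refine ⟨min η₀ (min ((D.R - 1) / 2) (ε / (4 * EstermannDisc.discA D.R * D.κ + 1))),
      lt_min hη₀ (lt_min (by linarith) (div_pos hε hden)), min_le_left _ _,
      (min_le_right _ _).trans (min_le_left _ _), ?_⟩
    have h1 : min η₀ (min ((D.R - 1) / 2) (ε / (4 * EstermannDisc.discA D.R * D.κ + 1))) ≤
        ε / (4 * EstermannDisc.discA D.R * D.κ + 1) := (min_le_right _ _).trans (min_le_right _ _)
    have h0 : 0 ≤ min η₀ (min ((D.R - 1) / 2) (ε / (4 * EstermannDisc.discA D.R * D.κ + 1))) :=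
      (lt_min hη₀ (lt_min (by linarith) (div_pos hε hden))).le
    rw [le_div_iff₀ hden] at h1
    nlinarith [mul_nonneg (mul_nonneg hA.le hκ) h0]
  have hηZ : ∀ σ : ℝ, |σ - 1| ≤ η → 0 < (D.Z σ).re := fun σ hσ => hη₀Z σ (hσ.trans hηη₀)
  by_cases hCase : ∃ (j₁ : ι) (β₁ : ℝ), 1 - η ≤ β₁ ∧ β₁ < 1 ∧ D.L j₁ β₁ = 0
  · /- Case B -/
    obtain ⟨j₁, β₁, hβ₁, hβ₁1, hzero⟩ := hCase
    have h1β : 0 < 1 - β₁ := by linarith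
    obtain ⟨T, hT⟩ := D.L_one_le (ε / 2) (by positivity)
    have hT'0 : 0 < max T 1 := by positivity
    have hT' : ∀ j, ‖D.L j 1‖ ≤ max T 1 * D.Q j ^ (ε / 2) := fun j =>
      (hT j).trans (mul_le_mul_of_nonneg_right (le_max_left _ _)
        (Real.rpow_nonneg (by linarith [D.one_le_Q j]) _))
    obtain ⟨Dp, hDp, hprin⟩ := D.principal_case (ε / 2) (by positivity)
    have hℓ₁ : 0 < (D.L j₁ 1).re := D.re_L_one_pos j₁
    have hQj0 : 0 < D.Q j₁ := by linarith [D.one_le_Q j₁]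
    have hCP : 0 < Dp * D.Q j₁ ^ (-(ε / 2)) * (D.L j₁ 1).re := by positivity
    have hCB : 0 < EstermannDisc.discC D.R * (1 - β₁) *
        (D.MZ * D.B ^ 3 + 1) ^ (-(EstermannDisc.discA D.R * η)) * D.Q j₁ ^ (-ε) /
        ((D.Z 1).re * (D.L j₁ 1).re * max T 1) := by positivity
    refine ⟨_, lt_min hCP hCB, fun i => ?_⟩
    have hQiε : 0 ≤ D.Q i ^ (-ε) := Real.rpow_nonneg (by linarith [D.one_le_Q i]) _
    by_cases hp : D.Principal i j₁
    · exact (mul_le_mul_of_nonneg_right (min_le_left _ _) hQiε).trans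
        (D.caseB_principal_bound hε hDp hprin hp)
    · exact (mul_le_mul_of_nonneg_right (min_le_right _ _) hQiε).trans
        (D.caseB_bound hε hηR hηε hβ₁ hβ₁1 hzero hT'0 hT' hp)
  · /- Case A -/
    push Not at hCase
    have hz : ∀ j (β : ℝ), 1 - η ≤ β → β < 1 → D.L j β ≠ 0 := fun j β h1 h2 => hCase j β h1 h2
    have hCA : 0 < EstermannDisc.discC D.R * η * (D.MZ * D.B + 1) ^ (-(EstermannDisc.discA D.R * η)) /
        (D.Z 1).re := by positivity
    have hηε' : D.κ * EstermannDisc.discA D.R * η ≤ ε := by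
      nlinarith [mul_nonneg (mul_nonneg hκ hA.le) hη.le]
    exact ⟨_, hCA, fun i => D.caseA_bound hη hηR hηε' hηZ hz i⟩

/-- **Siegel's theorem, abstract form, with the norm**: `‖L(1, χ_i)‖ ≥ C(ε) Q_i^{−ε}`.
[cite: MontgomeryVaughan2007, §11.2 Theorem 11.14] -/
theorem siegel_norm {ε : ℝ} (hε : 0 < ε) : ∃ C : ℝ, 0 < C ∧ ∀ i, C * D.Q i ^ (-ε) ≤ ‖D.L i 1‖ := by
  obtain ⟨C, hC, h⟩ := D.siegel hε
  exact ⟨C, hC, fun i => (h i).trans (le_of_eq (D.re_L_one_eq_norm i))⟩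

end SiegelFamilyData

end Literature.NumberTheory.LFunctions

end
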